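import Mathlib
import Summits.NavierStokesRegularity.NavierStokesRegularity.Theorems.SubOnsagerCeilingOrthantTailCeiling.Negative.OrthantTailCeilingFalseOfSideBranchCriticalEscapeEstimate
import HarnessLib

/-!
# `SubOnsagerCeiling.OrthantTailCeiling` (stmt-NavierStokesRegularity-25507) — negative lemma modulo a
# CEILING-ASSISTED, ONE-DEPTH escape (`SideBranchCeilingEscape`); the forward twin (stmt-26608) is the
# sibling file `…/SubOnsagerCeilingForwardTailCeiling/Negative/ForwardTailCeilingFalseOfSideBranchCeilingEscape.lean`

The negative lemmas of record for the side-branch dead-end table `α_SB = sideBranchTable` are modulo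
escape hypotheses that are A PRIORI (every regular solution, no other information) and asked at
INFINITELY MANY depths at the ONSAGER-CRITICAL rate `c·(1+ε₀)^{-K}` (`SideBranchCriticalEscapeEstimate`,
p823602 / p823762).  This file records the weakest hypothesis the metering argument of record actually
consumes, and it is weaker in three independent ways:

1. **the escape may be proved UNDER the ceiling.**  The refutation of `CeilingAt 10 ε₀ α_SB` is by
   contradiction, so while proving the escape one may ASSUME, along the solution, the full tail
   ceiling `Σ_{k=n..N} Σ_i ½X_{i,k}(u)² ≤ C·E₀·(1+ε₀)^{-2θn}` (`θ > 1/2`, `C ≥ 0` handed over first) and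
   the non-negativity on shells `≥ 1` (cone invariance, proved, item 24642/25508).  In particular the
   deeper Katz–Pavlović conveyor that drains the chain mode `x_{k+1}` is no longer adversarial: its
   drain rate is `≤ Λ_{k+1}·√(2CE₀)·(b^{-θ(k+2)} + b^{-θ(k+1)}/5)`, and every pocket holds
   `≤ C E₀ b^{-2θ(k+1)}`;
2. **one depth suffices.**  No `∀ K₀ ∃ K ≥ K₀`: a single block `0..K` (chosen after `θ, C`) will do;
3. **the escape need only beat the ceiling's own tail at the next shell**: the block `0..K` must lose an
   amount `w > C·E₀·(1+ε₀)^{-2θ(K+1)}` by a viscosity-uniform time — not a fixed fraction, not the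
   critical `c·(1+ε₀)^{-K}·E₀`.

**`orthantTailCeiling_false_of_sideBranchCeilingEscape : SideBranchCeilingEscape → ¬ OrthantTailCeiling`**
(BY NAME), with the per-table body `not_ceilingAt_sideBranch_of_ceilingEscape`, and the link
`sideBranchCeilingEscapeAt_of_criticalEscapeEstimateAt` (the hypothesis of record implies the new one, so
this file supersedes both negative lemmas of record).

WHY IT SUFFICES (same metering core as the record, `sideBranch_deepBlockLoss_le_of_shellCeiling`): under
the ceiling the tail between `K+1` and `K'` is `≤ C E₀ b^{-2θ(K+1)} = w − m` (`m > 0` the margin), the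
deeper block `0..K'` loses `≤ Φ₁ b^{-(θ-1/2)K'} + 2ν b^{2K'} E_max T`, which is `< m` for `K'` deep and `ν`
small; so the block `0..K` loses `< w` — contradicting the hypothesis applied to the (ceiling-obeying,
non-negative) global regular solution the ceiling itself supplies (`sideBranch_viscousGlobal_of_ceilingAt`).

WHAT REMAINS (honest, the whole content): for given `θ > 1/2`, `C ≥ 0`, ONE depth `K` and a datum such
that every non-negative regular solution OBEYING the `(θ, C)` tail ceiling pushes more than
`C E₀ b^{-2θ(K+1)}` out of the block `0..K` by a `ν`-uniform time.  Since along such a solution no energy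
is dissipated anomalously (metering) and the chain/side modes relax (LaSalle), this is a lower bound
`Σ_{j ≥ K+2} p_j + Φ > C E₀ b^{-2θ(K+1)}` on the energy NOT parked in the first `K+1` pockets — a
throughput bound for the chain in which the competing side pump is choked by its own pocket as soon as
`z_{k+1} ≥ 5·b^{5/2}√(2CE₀)(b^{-θ(k+2)} + b^{-θ(k+1)}/5)` (then `s_k ≤ s_k(τ₀)e^{-Λ_k z(τ₀)(t-τ₀)/5} + x_{k+1}/5`,
side capture `≤ 1/25` of chain capture).  Not constructed here.

HONEST FRAMING: MODEL lattice ODEs only (Tao 2016 §4 vocabulary; rung TL-M2Break); conditional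
refutations plus elementary bookkeeping; they settle nothing by themselves; no summit, rung or crux is
proved; nothing here is a statement about the Navier–Stokes equations.
[cite: Tao2016AveragedNS, §4 (4.2)–(4.3), (4.5), (4.8), the viscous equation before Thm. 4.2];
Katz–Pavlović couplings and their positivity: [cite: BarbatoMorandinRomito2011, §2].
-/

noncomputable section

-- the sub-problem namespace `NavierStokesRegularity.NavierStokesRegularity` is the tree's layout (D-0017)
set_option linter.dupNamespace false

namespace Summit.NavierStokesRegularity.NavierStokesRegularity.Theorems.SubOnsagerCeiling

open Set Filter MeasureTheory intervalIntegral
open scoped Topology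
open Literature.Analysis.FluidPDE.TaoCascade
open Summit.NavierStokesRegularity.NavierStokesRegularity.Theses.SubOnsagerCeiling

/-! ## §1 The ceiling-assisted one-depth escape hypothesis -/

/-- **`SideBranchCeilingEscapeAt ε₀` — CEILING-ASSISTED ONE-DEPTH ESCAPE for the side-branch table at
scale ratio `b = 1+ε₀`** (`Prop`; NOTHING asserted; the hypothesis this negative lemma is modulo).  For
every candidate ceiling exponent `θ > 1/2` and constant `C ≥ 0` there are ONE depth `K`, a one-shell
datum `X₀` of positive energy `E₀`, a horizon `T > 0`, a viscosity threshold `ν₀ > 0` and an escape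
amount `w > C·E₀·b^{-2θ(K+1)}` such that for every `0 < ν ≤ ν₀` some time `s ∈ (0, T]` has: EVERY regular
solution of the `ν`-viscous `α_SB` lattice on `[0, s]` from `X₀` (one-shell datum, no shells below `0`,
Tao's weight bound (4.5), continuous modes, exact viscous equation within `[0, s]`) WHICH MOREOVER is
non-negative on the shells `≥ 1` on `[0,s]` and obeys the `(θ, C)` tail ceiling
`Σ_{k=n..N} Σ_i ½X_{i,k}(u)² ≤ C E₀ b^{-2θn}` (`n ≤ N`, `u ∈ [0,s]`) has block energy
`Σ_{k ≤ K} Σ_i ½X_{i,k}(s)² ≤ E₀ − w`.  Implied by `SideBranchCriticalEscapeEstimateAt ε₀`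
(`sideBranchCeilingEscapeAt_of_criticalEscapeEstimateAt`).  A CONSTRUCTION TARGET, not a published fact.
[cite: Tao2016AveragedNS, §4 (4.5), the viscous equation before Thm. 4.2] -/
@[conjecture] def SideBranchCeilingEscapeAt (ε₀ : ℝ) : Prop :=
  ∀ θ : ℝ, 1 / 2 < θ → ∀ C : ℝ, 0 ≤ C → ∃ K : ℕ,
    ∃ X₀ : Fin 4 → ℝ, 0 < (∑ i : Fin 4, (1 / 2 : ℝ) * X₀ i ^ 2) ∧
    ∃ T : ℝ, 0 < T ∧ ∃ ν₀ : ℝ, 0 < ν₀ ∧ ∃ w : ℝ,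
      C * (∑ i : Fin 4, (1 / 2 : ℝ) * X₀ i ^ 2) * (1 + ε₀) ^ (-(2 * θ * ((K + 1 : ℕ) : ℝ))) < w ∧
      ∀ ν : ℝ, 0 < ν → ν ≤ ν₀ → ∃ s : ℝ, 0 < s ∧ s ≤ T ∧
      ∀ X : Fin 4 → ℤ → ℝ → ℝ,
        (∀ (i : Fin 4) (k : ℤ), X i k 0 = if k = 0 then X₀ i else 0) →
        (∀ (i : Fin 4) (k : ℤ), k < 0 → ∀ t : ℝ, X i k t = 0) →
        (∃ M : ℝ, ∀ (t : ℝ) (i : Fin 4) (k : ℤ), (1 + (1 + ε₀) ^ ((10 : ℝ) * k)) * |X i k t| ≤ M) →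
        (∀ (i : Fin 4) (k : ℤ), Continuous (X i k)) →
        (∀ (i : Fin 4) (k : ℤ), ∀ t ∈ Set.Icc (0 : ℝ) s, HasDerivWithinAt (X i k)
          (quadTerm ε₀ sideBranchTable X i k t - ν * (1 + ε₀) ^ ((2 : ℝ) * k) * X i k t)
          (Set.Icc (0 : ℝ) s) t) →
        (∀ t ∈ Set.Icc (0 : ℝ) s, ∀ (i : Fin 4) (k : ℤ), 1 ≤ k → 0 ≤ X i k t) →
        (∀ n N : ℕ, n ≤ N → ∀ u ∈ Set.Icc (0 : ℝ) s,
          ∑ k ∈ Finset.Icc n N, ∑ i : Fin 4, (1 / 2 : ℝ) * X i (k : ℤ) u ^ 2 ≤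
            C * (∑ i : Fin 4, (1 / 2 : ℝ) * X₀ i ^ 2) * (1 + ε₀) ^ (-(2 * θ * (n : ℝ)))) →
        (∑ k ∈ Finset.range (K + 1), ∑ i : Fin 4, (1 / 2 : ℝ) * X i (k : ℤ) s ^ 2) ≤
          (∑ i : Fin 4, (1 / 2 : ℝ) * X₀ i ^ 2) - w

/-- `SideBranchCeilingEscape`: the ceiling-assisted one-depth escape at SOME scale ratio `ε₀ ∈ (0, 1]`
(`Prop`; nothing asserted; the `H` of this negative lemma). [this file] -/
@[conjecture] def SideBranchCeilingEscape : Prop :=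
  ∃ ε₀ : ℝ, 0 < ε₀ ∧ ε₀ ≤ 1 ∧ SideBranchCeilingEscapeAt ε₀

/-- **The Onsager-critical estimate of record implies the ceiling-assisted one-depth escape.**  Given
`θ > 1/2` and `C`, the critical amount `c E₀ b^{-K}` exceeds the ceiling tail `C E₀ b^{-2θ(K+1)}` at every
large depth because `2θ > 1`; the extra hypotheses (non-negativity, ceiling) are simply not used.  So this
file's negative lemmas supersede `orthantTailCeiling_false_of_sideBranchCriticalEscapeEstimate` and its
forward twin. [this file] -/
theorem sideBranchCeilingEscapeAt_of_criticalEscapeEstimateAt {ε₀ : ℝ} (hε : 0 < ε₀)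
    (h : SideBranchCriticalEscapeEstimateAt ε₀) : SideBranchCeilingEscapeAt ε₀ := by
  intro θ hθ C hC
  obtain ⟨c, hc, hfam⟩ := h
  have hb : (0 : ℝ) < 1 + ε₀ := by linarith
  have hb1 : (1 : ℝ) < 1 + ε₀ := by linarith
  -- depth: `C · r^K < c/4`, `r = b^{-(2θ-1)} < 1`
  set r : ℝ := (1 + ε₀) ^ (-(2 * θ - 1)) with hrdef
  have hr0 : 0 ≤ r := Real.rpow_nonneg hb.le _
  have hr1 : r < 1 := Real.rpow_lt_one_of_one_lt_of_neg hb1 (by linarith)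
  have hc4 : 0 < c / 4 := by positivity
  have htendr : Tendsto (fun K : ℕ => C * r ^ K) atTop (𝓝 (C * 0)) :=
    (tendsto_pow_atTop_nhds_zero_of_lt_one hr0 hr1).const_mul C
  rw [mul_zero] at htendr
  obtain ⟨K₀, hK₀⟩ := Filter.eventually_atTop.1 (htendr.eventually (gt_mem_nhds hc4))
  obtain ⟨K, hKK₀, X₀, hE₀, T, hT, ν₀, hν₀, hν⟩ := hfam K₀
  have hCK : C * r ^ K < c / 4 := hK₀ K hKK₀
  set E₀ : ℝ := ∑ i : Fin 4, (1 / 2 : ℝ) * X₀ i ^ 2 with hE₀def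
  refine ⟨K, X₀, hE₀, T, hT, ν₀, hν₀, c * E₀ * (1 + ε₀) ^ (-(K : ℝ)), ?_, fun ν hνpos hνle => ?_⟩
  · -- `C E₀ b^{-2θ(K+1)} ≤ (c/4) E₀ b^{-K} < c E₀ b^{-K}`
    have h1 := sideBranch_ceilingTail_le_quarter hε (by linarith) hC hE₀.le K hCK.le
    have hbK : 0 < (1 + ε₀) ^ (-(K : ℝ)) := Real.rpow_pos_of_pos hb _
    have h2 : c / 4 * E₀ * (1 + ε₀) ^ (-(K : ℝ)) < c * E₀ * (1 + ε₀) ^ (-(K : ℝ)) := by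
      have : 0 < E₀ * (1 + ε₀) ^ (-(K : ℝ)) := mul_pos hE₀ hbK
      nlinarith
    exact h1.trans_lt h2
  · obtain ⟨s, hs, hsT, hall⟩ := hν ν hνpos hνle
    refine ⟨s, hs, hsT, fun X hinit hlow hbd hcont hder _hpos _hceil => ?_⟩
    have h1 := hall X hinit hlow hbd hcont hder
    have h2 : (1 - c * (1 + ε₀) ^ (-(K : ℝ))) * E₀ = E₀ - c * E₀ * (1 + ε₀) ^ (-(K : ℝ)) := by ring
    rw [h2] at h1
    exact h1

/-! ## §2 CEILING ⇒ NO ESCAPE BEYOND THE CEILING'S OWN TAIL (the quantitative core, repackaged) -/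

/-- **`SideBranchCeilingEscapeAt ε₀ → ¬ CeilingAt 10 ε₀ α_SB`.**  Under the ceiling with exponent
`θ > 1/2` and constant `C`: take the depth `K`, datum, horizon, threshold and escape amount
`w = C E₀ b^{-2θ(K+1)} + m` (`m > 0`) of the hypothesis AT THIS `(θ, C)`; choose `K' ≥ K+1` with
`Φ₁(C,θ,T)·b^{-(θ-1/2)K'} < m/2` (metering of record at the bond `K'`) and `ν` below the threshold with
block dissipation `2ν b^{2K'} E_max T ≤ m/2`; the ceiling supplies a global regular solution at that `ν`
(engine of record), clamped to the window `[0,s]`, non-negative on shells `≥ 1` (cone invariance) and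
obeying the ceiling: its block `0..K` has lost `< (w - m) + m = w`, contradicting the hypothesis.
MODEL lattice only. [this file] -/
theorem not_ceilingAt_sideBranch_of_ceilingEscape {ε₀ : ℝ} (hε : 0 < ε₀)
    (hH : SideBranchCeilingEscapeAt ε₀) : ¬ CeilingAt 10 ε₀ sideBranchTable := by
  intro hCeil
  obtain ⟨θ, hθ, C, hC, hceil⟩ := hCeil sideBranchTable_inTableClass sideBranchTable_orthant
  obtain ⟨K, X₀, hE₀, T, hT, ν₀, hν₀, w, hw, hν⟩ := hH θ hθ C hC
  have hb : (0 : ℝ) < 1 + ε₀ := by linarith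
  have hb1 : (1 : ℝ) < 1 + ε₀ := by linarith
  set E₀ : ℝ := ∑ i : Fin 4, (1 / 2 : ℝ) * X₀ i ^ 2 with hE₀def
  have hE₀0 : 0 ≤ E₀ := hE₀.le
  -- the margin over the ceiling's own tail at the shell `K+1`
  set tail : ℝ := C * E₀ * (1 + ε₀) ^ (-(2 * θ * ((K + 1 : ℕ) : ℝ))) with htaildef
  set m : ℝ := w - tail with hmdef
  have hm : 0 < m := by rw [hmdef]; linarith
  have hm2 : 0 < m / 2 := by positivity
  -- Step 1: the deeper bond `K'` with `Φ₁ q^{K'} < m/2`, `q = b^{-(θ-1/2)} < 1`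
  set A : ℝ := Real.sqrt (2 * C * E₀) with hAdef
  set Φ₁ : ℝ := (5 + T / 2 + 25 * Real.exp 1 / 2 + Real.exp 1) * A ^ 2 +
    5 * Real.exp 1 / 2 * A ^ 3 + 5 * T / 2 * A with hΦ₁def
  set q : ℝ := (1 + ε₀) ^ (-(θ - 1 / 2)) with hqdef
  have hq0 : 0 ≤ q := Real.rpow_nonneg hb.le _
  have hq1 : q < 1 := Real.rpow_lt_one_of_one_lt_of_neg hb1 (by linarith)
  have htend : Tendsto (fun K' : ℕ => Φ₁ * q ^ K') atTop (𝓝 (Φ₁ * 0)) :=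
    (tendsto_pow_atTop_nhds_zero_of_lt_one hq0 hq1).const_mul Φ₁
  rw [mul_zero] at htend
  obtain ⟨K', hK'small, hK'ge⟩ := ((htend.eventually (gt_mem_nhds hm2)).and
    (eventually_ge_atTop (K + 1))).exists
  have hqK' : (1 + ε₀) ^ (-((θ - 1 / 2) * (K' : ℝ))) = q ^ K' := by
    rw [show -((θ - 1 / 2) * (K' : ℝ)) = (-(θ - 1 / 2)) * (K' : ℝ) by ring,
      Real.rpow_mul_natCast hb.le]
  -- Step 2: the viscosity
  set Emax : ℝ := C * E₀ * ((K' : ℝ) + 1) with hEmaxdef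
  have hEmax0 : 0 ≤ Emax := by positivity
  set D : ℝ := 2 * (1 + ε₀) ^ ((2 : ℝ) * (K' : ℝ)) * Emax * T + 1 with hDdef
  have hD0 : 0 < D := by positivity
  set ν₁ : ℝ := min ν₀ (min 1 (min (1 / ((1 + ε₀) ^ ((2 : ℝ) * ((K' : ℝ) + 1)) * T)) ((m / 2) / D)))
    with hν₁def
  have hν₁ : 0 < ν₁ := lt_min hν₀ (lt_min one_pos (lt_min (by positivity) (by positivity)))
  have hν₁0 : ν₁ ≤ ν₀ := min_le_left _ _
  have hν11 : ν₁ ≤ 1 := (min_le_right _ _).trans (min_le_left _ _)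
  have hν12 : ν₁ ≤ 1 / ((1 + ε₀) ^ ((2 : ℝ) * ((K' : ℝ) + 1)) * T) :=
    (min_le_right _ _).trans ((min_le_right _ _).trans (min_le_left _ _))
  have hν13 : ν₁ ≤ (m / 2) / D :=
    (min_le_right _ _).trans ((min_le_right _ _).trans (min_le_right _ _))
  obtain ⟨s, hs, hsT, hall⟩ := hν ν₁ hν₁ hν₁0
  -- Step 3: a global regular solution at viscosity `ν₁` (free under the ceiling), clamped to `[0,s]`
  obtain ⟨Xg, hXg⟩ := sideBranch_viscousGlobal_of_ceilingAt hε hCeil ν₁ hν₁ X₀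
  obtain ⟨hinit, hlow, hbd, hcont, hder⟩ := viscousGlobal_window hXg hs
  -- cone invariance (item 25508, proved): non-negative on shells `≥ 1`
  have hpos := orthantInvariance_proof ε₀ ν₁ hε hν₁ sideBranchTable sideBranchTable_orthant X₀ s hs _
    hinit hlow hbd hcont hder
  -- the ceiling along the solution: tail form and per-shell form
  have htail := fun (n N : ℕ) (hnN : n ≤ N) (u : ℝ) (hu : u ∈ Icc (0 : ℝ) s) =>
    hceil ν₁ hν₁ X₀ s hs _ hinit hlow hbd hcont hder hpos n N hnN u hu
  have hshell : ∀ u ∈ Icc (0 : ℝ) s, ∀ k : ℕ,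
      ∑ i : Fin 4, (1 / 2 : ℝ) * Xg i (k : ℤ) (max 0 (min u s)) ^ 2 ≤
        C * (∑ i : Fin 4, (1 / 2 : ℝ) * X₀ i ^ 2) * (1 + ε₀) ^ (-(2 * θ * (k : ℝ))) := by
    intro u hu k
    have h := htail k k le_rfl u hu
    rw [Finset.Icc_self, Finset.sum_singleton] at h
    exact h
  -- the hypothesis applied to this (non-negative, ceiling-obeying) solution: block `0..K` lost `≥ w`
  have hloss := hall _ hinit hlow hbd hcont hder hpos htail
  -- Step 4: the loss of the deep block `0..K'` (metering of record)
  have hss : s ∈ Icc (0 : ℝ) s := ⟨hs.le, le_rfl⟩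
  have hK'1 : 1 ≤ K' := le_trans (by omega) hK'ge
  have hP0 : 0 < (1 + ε₀) ^ ((2 : ℝ) * ((K' : ℝ) + 1)) * T := by positivity
  have hνt : ν₁ * (1 + ε₀) ^ ((2 : ℝ) * ((K' : ℝ) + 1)) * s ≤ 1 := by
    calc ν₁ * (1 + ε₀) ^ ((2 : ℝ) * ((K' : ℝ) + 1)) * s
        ≤ ν₁ * (1 + ε₀) ^ ((2 : ℝ) * ((K' : ℝ) + 1)) * T := by gcongr
      _ ≤ 1 / ((1 + ε₀) ^ ((2 : ℝ) * ((K' : ℝ) + 1)) * T) *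
            (1 + ε₀) ^ ((2 : ℝ) * ((K' : ℝ) + 1)) * T := by gcongr
      _ = 1 := by field_simp
  have hdeep := sideBranch_deepBlockLoss_le_of_shellCeiling hε hν₁.le hν11 hθ hC hinit hlow hcont hder
    hs hsT hshell K' hK'1 hνt
  rw [← hE₀def, ← hAdef, ← hΦ₁def, hqK', ← hEmaxdef] at hdeep
  -- dissipation of the deep block: `2 ν_{K'} E_max s ≤ m/2`
  have hdiss : 2 * (ν₁ * (1 + ε₀) ^ ((2 : ℝ) * (K' : ℝ))) * Emax * s ≤ m / 2 := by
    have h1 : 2 * (ν₁ * (1 + ε₀) ^ ((2 : ℝ) * (K' : ℝ))) * Emax * s ≤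
        2 * (((m / 2) / D) * (1 + ε₀) ^ ((2 : ℝ) * (K' : ℝ))) * Emax * T := by gcongr
    have h2 : 2 * (((m / 2) / D) * (1 + ε₀) ^ ((2 : ℝ) * (K' : ℝ))) * Emax * T =
        (m / 2) * ((2 * (1 + ε₀) ^ ((2 : ℝ) * (K' : ℝ)) * Emax * T) / D) := by
      field_simp
    have h3 : (2 * (1 + ε₀) ^ ((2 : ℝ) * (K' : ℝ)) * Emax * T) / D ≤ 1 := by
      rw [div_le_one hD0, hDdef]
      linarith
    have h4 : (m / 2) * ((2 * (1 + ε₀) ^ ((2 : ℝ) * (K' : ℝ)) * Emax * T) / D) ≤ m / 2 :=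
      mul_le_of_le_one_right hm2.le h3
    linarith
  -- Step 5: the tail between `K+1` and `K'` under the ceiling: `≤ C E₀ b^{-2θ(K+1)} = w - m`
  have hmid : ∑ k ∈ Finset.Icc (K + 1) K', ∑ i : Fin 4,
      (1 / 2 : ℝ) * Xg i (k : ℤ) (max 0 (min s s)) ^ 2 ≤ tail := htail (K + 1) K' hK'ge s hss
  -- Step 6: split the deep block and compare with the claimed escape `w = tail + m`
  rw [sideBranch_sum_range_split _ hK'ge] at hdeep
  have hwm : w = tail + m := by rw [hmdef]; ring
  rw [hwm] at hloss
  linarith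

/-! ## §3 The conditional refutation of the crux by name -/

/-- **Negative lemma (conditional refutation of the crux BY NAME, ceiling-assisted form).**
`SideBranchCeilingEscape → ¬ OrthantTailCeiling`: the crux quantifies over all spreads `R ≥ 1`, all
`ε₀ ∈ (0,1]` and all orthant tables of `E₂(R)`; `α_SB ∈ E₂(10)` is orthant, and at `(10, ε₀, α_SB)` its
body is refuted by `not_ceilingAt_sideBranch_of_ceilingEscape`.  MODEL lattice only; conditional;
settles nothing by itself. [this file] -/
theorem orthantTailCeiling_false_of_sideBranchCeilingEscape (hH : SideBranchCeilingEscape) :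
    ¬ OrthantTailCeiling := by
  obtain ⟨ε₀, hε, hε1, hHε⟩ := hH
  intro hOTC
  rw [orthantTailCeiling_iff_ceilingAt] at hOTC
  exact not_ceilingAt_sideBranch_of_ceilingEscape hε hHε (hOTC 10 (by norm_num) ε₀ hε hε1 sideBranchTable)

/-- Gate-shaped alias (`<Decl>_false_of_<H>`): `SideBranchCeilingEscape → ¬ OrthantTailCeiling`.
MODEL lattice only; conditional; settles nothing by itself. [this file] -/
theorem OrthantTailCeiling_false_of_SideBranchCeilingEscape :
    SideBranchCeilingEscape → ¬ OrthantTailCeiling :=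
  orthantTailCeiling_false_of_sideBranchCeilingEscape

end Summit.NavierStokesRegularity.NavierStokesRegularity.Theorems.SubOnsagerCeiling

end
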